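import Summits.Ventures.AbcSig.Rows.XTemplateBC6
import Summits.Ventures.AbcSig.Rows.XTemplateBC
import Summits.Ventures.AbcSig.Levels.N361
import Summits.Ventures.AbcSig.Levels.N722
import Summits.Ventures.AbcSig.Levels.N361Q2

/-!
# Venture AbcSig — ROW `Xn64Yn19Z2`: `xⁿ + 64 yⁿ = 19 z²` (FAMILY C1b, `α = 6`; GENERATED by p-lean gen3/leanrow_c1b6.py)

Q-VARIANT (p-lean g6 `gen6/spatch2.py`): same statement shape as `xrow_Xn64Yn19Z2` plus ONE more named CITED hypothesis `(hQ : M.Q2Package)` (`Recipes/Q2Package.lean`: the cell's q = 2 rule at ODD level, allowed traces {±1, ±3}), in exchange for which the residual pair(s) 361.1 @ 7, 361.2 @ 7 — closed in the row of record only by the sieve prime q = 2 (citation-backing audit plean/g5/THETAVERIFY-RECORD.md Part C, class Q2-RULE), previously opaque CITED hypotheses `hX_…` — are discharged IN THE KERNEL (`Levels/N361Q2.lean`: the orbit's eigenvalues including `c₂`, mod-n TreeN certificate against `q2Allowed`) under the COMPUTED hypothesis `hQ2_… : ∀ f, Matches f orbit → Matches f q2`.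
HONEST FRAMING. A row of a COMPUTATION cell (`pub-abcsig`); a CONDITIONAL theorem, no claim on ABC or any summit.
Hypotheses: `BS04Package` (CITED: [BS04] Lemma 3.3 + (3.1) + Lemma 4.2), `DataComplete` at the levels
361 = 19² (`y` odd, case (v₆)) and 722 = 2·19² (`y` even, case (v₇)) (COMPUTED, certified level files), `Refines…` of
kernel module certificates (COMPUTED) if any, and the listed per-orbit exclusions `hX_…` (CITED; the row of record's R3/R5
name the module / printed argument per orbit: M4 Kraus certificates, M6c, [BS04, Prop. 4.4 / 4.6]). Everything else is
kernel-checked (`Rows/XTemplateBC6.lean`, `Rows/XTemplateBC.lean`, `Levels/N….lean`).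
Exponent range: prime `n ≥ 7`, n ∉ [19]; `x·y ≠ ±1`.
Row of record: `census/rows/C1b/C1b-C19-a6.md` (sha16 `3c336d77a829c75e`; R8-signed by referee ref-g20, 2026-08-22T23:18Z); p1's statement of record: the conjunct `Rows.C1bCell 19 (fun _ α => α = 6) 7 ∅` of `Rows.C1bExtSigned` (`Rows/StatementsC1b.lean`). Level 361 = 19² generated on the hub from the census level file (engine-1 Sturm file; for 361 the census holds only the engine-2 file census/levels/N361.engine2.json, no c5′ row). Residual exponents of OUR kernel sieve that the row closes by a module (M4 Kraus — family-specific —, M6 / M6c, [BS04, Prop. 4.4 / 4.6]) enter as the named hypotheses `hX_… : n ∈ [...] → M.Excludes …` (CITED), as do rational orbits not eliminable by the sieve (all n).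
-/

namespace Summit.Ventures.AbcSig

/-- Row `Xn64Yn19Z2`: no primitive solution of `xⁿ + 64 yⁿ = 19 z²` with `x·y ≠ ±1` for prime `n ≥ 7`, `n ∉ [19]`,
conditional on the named hypotheses. -/
theorem xrow_Xn64Yn19Z2Q (M : NewformModel) (hP : M.BS04Package) (hQ : M.Q2Package)
    (hD361 : M.DataComplete 361 level361Orbits) (hD722 : M.DataComplete 722 level722Orbits)
    (n : ℕ) (hn : n.Prime) (hmin : 7 ≤ n) (hres : n ∉ ([19] : List ℕ))
    (hQ2_orbit_361_1 : ∀ f : M.Form 361, M.Matches f orbit_361_1 → M.Matches f q2_361_1)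
    (hQ2_orbit_361_2 : ∀ f : M.Form 361, M.Matches f orbit_361_2 → M.Matches f q2_361_2)
    (hX_orbit_722_1 : n ∈ ([7] : List ℕ) → M.Excludes 722 orbit_722_1
      (famBC 6 19 n (fun _ b => 2 ∣ b)))
    (hX_orbit_722_6 : n ∈ ([7] : List ℕ) → M.Excludes 722 orbit_722_6
      (famBC 6 19 n (fun _ b => 2 ∣ b)))
    (hX_orbit_722_7 : n ∈ ([7] : List ℕ) → M.Excludes 722 orbit_722_7
      (famBC 6 19 n (fun _ b => 2 ∣ b)))
    (hX_orbit_722_8 : n ∈ ([7] : List ℕ) → M.Excludes 722 orbit_722_8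
      (famBC 6 19 n (fun _ b => 2 ∣ b)))
    (x y z : ℤ) (hxy1 : x * y ≠ 1) (hxy2 : x * y ≠ -1) : ¬ IsPrimitiveSolution 1 (2 ^ 6) 19 n x y z := by
  have h7 : 7 ≤ n := by omega
  have hC : Nat.Prime 19 := by norm_num
  have hsq : Squarefree (19 : ℕ) := (Nat.prime_iff.mp hC).squarefree
  have hnC : ¬ n ∣ 19 := by
    intro h
    simp only [List.mem_cons, List.not_mem_nil, or_false] at hres; rcases (Nat.dvd_prime hC).mp h with h1 | h1 <;> omega
  by_cases hy : 2 ∣ y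
  · exact xbranchBC_v7 6 19 hsq (by decide) M hP hD722 n hn h7 hnC (by omega)
      (level722_sieve n hn h7 (fun o => M.Excludes 722 o
      (famBC 6 19 n (fun _ b => 2 ∣ b)) ∨ M.ExcludesStd 722 o n) (fun hmem => by
      obtain rfl : n = 7 := by simpa using hmem
      exact Or.inl (hX_orbit_722_1 (by simp))) (fun hmem => by
      obtain rfl : n = 7 := by simpa using hmem
      exact Or.inl (hX_orbit_722_6 (by simp))) (fun hmem => by
      obtain rfl : n = 7 := by simpa using hmem
      exact Or.inl (hX_orbit_722_7 (by simp))) (fun hmem => by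
      obtain rfl : n = 7 := by simpa using hmem
      exact Or.inl (hX_orbit_722_8 (by simp))) (fun hmem => by
      obtain rfl : n = 19 := by simpa using hmem
      exact absurd (by simp) hres) (fun hmem => by
      obtain rfl : n = 19 := by simpa using hmem
      exact absurd (by simp) hres))
      x y z hy hxy1 hxy2
  · exact xbranchBC_v6 19 hsq (by decide) M hP hD361 n hn h7 hnC
      (level361_sieve n hn h7 (fun o => M.Excludes 361 o
      (famBC 6 19 n (fun _ b => ¬ 2 ∣ b)) ∨ M.ExcludesStd 361 o n) (fun hmem => by
      obtain rfl : n = 7 := by simpa using hmem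
      exact Or.inr (orbit_361_1_exclStdQ2_7 M hQ hQ2_orbit_361_1)) (fun hmem => by
      obtain rfl : n = 7 := by simpa using hmem
      exact Or.inr (orbit_361_2_exclStdQ2_7 M hQ hQ2_orbit_361_2)))
      x y z hy hxy1 hxy2

end Summit.Ventures.AbcSig
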